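import Summits.BirchSwinnertonDyer.BirchSwinnertonDyer.Theorems.SemiOrdinaryEisensteinDescentEisensteinKernelAtThreeTowerFreeOddOfValueAtOne
import Summits.BirchSwinnertonDyer.BirchSwinnertonDyer.Theorems.SemiOrdinaryEisensteinDescentWildKolyvaginUpperAtThreeTowerFreePrintClosedSubcells
import HarnessLib

/-!
# Route `SemiOrdinaryEisensteinDescent`: the `closes` kernels keyed on the MINIMAL Eisenstein currency `E_𝟙^V`
# (value at 𝟙, odd `d_K`, AT a displayed unit value) — kernel⁗ (p606694) and the act-G kernel‴′ (25899 shape) re-run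
# with `E_𝟙′ ↦ E_𝟙^V`; and `E_𝟙′ ⟹ E_𝟙^V` by name
# (cell `pub/bsd-wall`, width seat `bsd-wall-soed-p1-w2` g12, `--supports stmt-BirchSwinnertonDyer-24155`, helper)

WHY. The route's deciding chain consumes its Eisenstein crux (#2 E 20479 aside → #2′ E′ 24155 → queued #2″ `E_𝟙′`
`WildSplitEisensteinValueAtOneRestricted`, pen act G′) ONLY at the Friedberg–Hoffstein field (odd `d_K`) and ONLY at the
`R₀`-frame carrying a unit value display `L(𝟙) = u·(log_ω P/c)²` (w2 g4, `…WildSplitEisensteinInclusionAtThreeTight`,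
p591437: that statement, `E_𝟙^V`, is EQUIVALENT to the leaf modulo the route's other items — no surplus over BSD₃).
Width seat soed-p1-w3 g8 (STATUS 2026-08-28T06:02:49Z) recorded the typing datum for the pen: the queued `E_𝟙′` text
quantifies the norm inequality over ALL frames (even `d_K`, every branch `ι′`, every period pair), while the kernel needs
`E_𝟙^V` only; «if the pen prefers a lined crux, type #2″ as `E_𝟙^V` and key the G′ kernel on it (variant of kernel⁗
p606694, which already holds `hodd / u / hval` where it applies `hE1`)». THIS FILE is that variant, certified, so either
typing of #2″ re-binds `closes` at zero glue cost:

* §1 `wAllExclAddWildRankOneSurj_of_valueAtOneV_of_koTowerFree_of_frameOdd_of_poitouTate` —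
  `PublishedInputsWildThree → E_𝟙^V → WildKolyvaginUpperAtThreeTowerFree → WildSplitPrintedInputsAtThree →
  WildSplitFrameAtThreeOddOfPrint → PoitouTateSelmerStructureDualityFact → WildRankZeroTwistAtThree → WAllExclAddWildRankOneSurj`
  (p606694 §1 VERBATIM except that the Eisenstein step receives `hodd` and the unit value display `u, hval` the proof
  holds at that point — exactly as w2 g4's `Tight.wAllExclAddWildRankOneSurj_of_valueAtOneV` did for the old kernel).
* §2 `…_of_valueAtOneV_of_koTowerFree_of_package_of_poitouTate` — the frame item 24475 (CLOSED) discharged by name.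
* §3 `…_of_valueAtOneV_of_sigmaMultiCarrier_of_jetchevMaxModThree_of_primitives_of_poitouTate` — the act-G shape
  (route rev 18): `PublishedInputsWildThree → E_𝟙^V → KolyvaginPrimitivesAtThree → JetchevMaxDivisibilityAtThreeModThree →
  WildSigmaDivisibilityAtThreeMultiCarrier → WildSplitPrintedInputsAtThree → PoitouTateSelmerStructureDualityFact →
  WildRankZeroTwistAtThree → WAllExclAddWildRankOneSurj` — i.e. the act-G′ kernel `EisensteinKernelAtThreeMultiCarrierOddOfValueAtOne`
  with `E_𝟙′` weakened to `E_𝟙^V` (Ko′ from the three McCallum-road primitives + Jetchev max-form mod 3 + `J‴`, soed-p2's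
  p598295 `…PrintClosedSubcells.wildKolyvaginUpperAtThreeTowerFree_of_sigmaMultiCarrier_of_jetchevMaxModThree_of_threePrimitives`).
* §4 `valueAtOneV_of_valueAtOneRestricted` — `E_𝟙′ ⟹ E_𝟙^V` BY TEXT (drop `hodd`, `u`, `hval`): the queued crux #2″ implies
  the minimal currency, so §1–§3 also give the `E_𝟙′`-keyed kernels (kernel⁗ §1/§2 = §1/§2 ∘ §4; act-G′ kernel = §3 ∘ §4).

HONEST FRAMING: CONDITIONAL on every displayed antecedent — `E_𝟙^V` is the research content of the Eisenstein crux
(= the «≥» half of the 3-part of #Ш(E/K) at Friedberg–Hoffstein data on the onto wild r₁ cell; no engine in print: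
walls W1–W3 of `Cruxes/WildSplitEisensteinInclusionAtThree/Lines/birth-dead*.md`), `J‴` / Jetchev max-form at the
additive prime 3 are research / tree debt, Z is the open rank-zero wild leaf, the rest is print; theorems only; closes
nothing; BSD₃ is proved for no curve by this file. No definition, no named fact, no `sorry`.

References: [JetchevSkinnerWan2017] Thm. 3.3.1, §7.4.1 (arXiv:1512.06894 pp. 11, 30); [LiuZhangZhang2018] Thm 1.5.1/1.5.3;
[MilneADT2006] I Thm. 4.10(b); [Castella2018] Thm. 2.3, §5; [GrossZagier1986] I.(6.3), V §2; [FriedbergHoffstein1995] Thm. B;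
[McCallumLMS1991] §3; [GrossLMS1991] Prop. 3.7(2), §6; [Kolyvagin1990] Thm. A; [Jetchev2008] Thm. 1.4; [Hsieh2014] Thm. A;
[BertoliniDarmonPrasanna2013] Thm. 5.13.
-/

noncomputable section

open scoped Classical NumberField

set_option linter.dupNamespace false -- `Summit.BirchSwinnertonDyer.BirchSwinnertonDyer.Theorems.…` (summit = sub, D-0017)
set_option autoImplicit false

namespace Summit.BirchSwinnertonDyer.BirchSwinnertonDyer.Theorems.EisensteinKernelAtThreeOfValueAtOneV

open WeierstrassCurve NumberField IsDedekindDomain Field PowerSeries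
  Literature.NumberTheory.EllipticCurves
  Literature.NumberTheory.EllipticCurves.ModularForms
  Literature.NumberTheory.EllipticCurves.Rank1Residual
  Literature.NumberTheory.EllipticCurves.KrizLi2019
  Literature.NumberTheory.GaloisCohomology
  Summit.BirchSwinnertonDyer.Rank1Residual
  Summit.BirchSwinnertonDyer.Rank1Residual.Additive
  Summit.BirchSwinnertonDyer.Rank1Residual.X11b
  Summit.BirchSwinnertonDyer.Rank1Residual.X11b.AcSelmer
  Summit.BirchSwinnertonDyer.Rank1Residual.X11b.Halves
  Summit.BirchSwinnertonDyer.BirchSwinnertonDyer.Theses.SemiOrdinaryEisensteinDescent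
  Summit.BirchSwinnertonDyer.BirchSwinnertonDyer.Theorems

/-! ### §1 Kernel⁗ with `E_𝟙′` weakened to `E_𝟙^V` -/

/-- **`PublishedInputsWildThree → E_𝟙^V → WildKolyvaginUpperAtThreeTowerFree → WildSplitPrintedInputsAtThree →
WildSplitFrameAtThreeOddOfPrint → PoitouTateSelmerStructureDualityFact → WildRankZeroTwistAtThree → WAllExclAddWildRankOneSurj`**
— kernel⁗ (p606694 §1) with its Eisenstein antecedent `E_𝟙′` replaced by the MINIMAL currency `E_𝟙^V` (`hE1V`, w2 g4's
display: at every frame of every Heegner datum of the cell with `L(E^(d_K),1) ≠ 0`, `P = y_K` non-torsion, `d_K` ODD,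
`X_(∅,0)` torsion at `𝔭′` and a unit value display `𝓛(𝟙) = u·(log_ω P/c)²`, every characteristic generator `f` has
`‖f(𝟙)‖₃ ≤ ‖𝓛(𝟙)‖₃`). Jetchev–Skinner–Wan's §7.4 assembly at the wild split `3` without tower split: Friedberg–Hoffstein
field (`2` and all of `N(E)` split: odd `d_K ≠ -3`), Heegner point, Gross–Zagier, Kolyvagin, frame `(κ, γ, 𝔭, 𝔭′)`,
`R₀`-frame at `𝔭` from print with unit value forced by LZZ, `≤`-control + CTL₀ at `𝔭′` from PT1, `E_𝟙^V` at the frame and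
at that unit value ⟹ lower socket, Ko′ ⟹ upper socket, both at slack `v₃(c)` ⟹ p528981 with the rank-zero leaf. Every
crux / fact is an antecedent; closes nothing; BSD is not proved by this.
[cite: JetchevSkinnerWan2017, Thm. 3.3.1 and §7.4.1 (arXiv:1512.06894 pp. 11, 30)]
[cite: LiuZhangZhang2018, Thm 1.5.1 and Thm 1.5.3 (Duke Math. J. 167 pp. 748–749)] [cite: MilneADT2006, Ch. I, Thm. 4.10(b)]
[cite: GrossZagier1986, Thm. I.(6.3) and V.§2] [cite: FriedbergHoffstein1995, Thm. B] -/
theorem wAllExclAddWildRankOneSurj_of_valueAtOneV_of_koTowerFree_of_frameOdd_of_poitouTate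
    (hF : PublishedInputsWildThree)
    (hE1V : ∀ (W : WeierstrassCurve ℚ) [W.IsElliptic] [W.IsGloballyMinimal] (N : ℕ) [NeZero N] (K : Type) [Field K] [NumberField K] (Dt : Literature.NumberTheory.EllipticCurves.ModularForms.ModularParametrizationData W N) (H : Literature.NumberTheory.EllipticCurves.HeegnerDatum N (NumberField.discr K)) (ι : K →+* ℂ) (P : (W.baseChange K).toAffine.Point), Summit.BirchSwinnertonDyer.Rank1Residual.Additive.ClassO6 W 3 → W.HasSurjectiveModNGaloisRep 3 → W.analyticRank = 1 → W.conductorNorm ℤ = N → Literature.NumberTheory.EllipticCurves.IsImaginaryQuadratic K → Literature.NumberTheory.EllipticCurves.SatisfiesHeegnerHypothesis N K → (W.quadraticTwist (NumberField.discr K : ℚ)).entireLFunction 1 ≠ 0 → (WeierstrassCurve.Affine.Point.map ι.toRatAlgHom) P = Literature.NumberTheory.EllipticCurves.ModularForms.heegnerPointComplex Dt H → ¬ IsOfFinAddOrder P → Odd (NumberField.discr K) → ∀ (κ : Literature.NumberTheory.EllipticCurves.ZpExtension K 3), κ.IsAnticyclotomic → ∀ (γ : Field.absoluteGaloisGroup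 K) [Fact (κ.IsTopGenerator γ)] (𝔭 : IsDedekindDomain.HeightOneSpectrum (NumberField.RingOfIntegers K)) (h𝔭 : ((3 : ℕ) : NumberField.RingOfIntegers K) ∈ 𝔭.asIdeal) (he : 𝔭.asIdeal.ramificationIdx (NumberField.RingOfIntegers ℚ) = 1) (hf : 𝔭.asIdeal.inertiaDeg (NumberField.RingOfIntegers ℚ) = 1), ∀ (𝔭' : IsDedekindDomain.HeightOneSpectrum (NumberField.RingOfIntegers K)), ((3 : ℕ) : NumberField.RingOfIntegers K) ∈ 𝔭'.asIdeal → 𝔭' ≠ 𝔭 → ∀ (ι' : PadicAlgCl 3 ≃+* ℂ), Summit.BirchSwinnertonDyer.BirchSwinnertonDyer.Theorems.SchneiderFree.BranchInducesPrime 3 ι' 𝔭 → ∀ (ΩK : ℂ) (Ωp : ℂ_[3]) (L : Literature.NumberTheory.EllipticCurves.UnrSeries 3), ΩK ≠ 0 → Ωp ≠ 0 → Literature.NumberTheory.EllipticCurves.IsBDPLFunction ι' 𝔭 κ γ Dt.f ΩK Ωp L → Module.IsTorsion (Literature.NumberTheory.EllipticCurves.IwasawaAlgebra 3) (Summit.BirchSwinnertonDyer.Rank1Residual.X11b.AcSelmer.XAc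 (W.baseChange K) 3 κ 𝔭' ∅ γ) → ∀ (u : (Literature.NumberTheory.EllipticCurves.unrIntegers 3)ˣ), L.HasValueAt 0 ((((u : Literature.NumberTheory.EllipticCurves.unrIntegers 3) : Literature.NumberTheory.EllipticCurves.unrIntegers 3) : ℂ_[3]) * (algebraMap ℚ_[3] ℂ_[3] (Summit.BirchSwinnertonDyer.Rank1Residual.X11b.Halves.logOmega W 3 (Summit.BirchSwinnertonDyer.Rank1Residual.X11b.embAt K 3 𝔭 h𝔭 he hf) P / (Dt.c : ℚ_[3]))) ^ 2) → ∀ (f : Literature.NumberTheory.EllipticCurves.IwasawaAlgebra 3), Summit.BirchSwinnertonDyer.Rank1Residual.X11b.AcSelmer.XAc.charIdeal (W.baseChange K) 3 κ 𝔭' ∅ γ = Ideal.span {f} → ‖((PowerSeries.constantCoeff f : ℤ_[3]) : ℚ_[3])‖ ≤ ‖((PowerSeries.constantCoeff L : Literature.NumberTheory.EllipticCurves.unrIntegers 3) : ℂ_[3])‖)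
    (hKoly : WildKolyvaginUpperAtThreeTowerFree)
    (hW : WildSplitPrintedInputsAtThree)
    (hS : WildSplitFrameAtThreeOddOfPrint)
    (hPT : PoitouTateSelmerStructureDualityFact)
    (hZ : WildRankZeroTwistAtThree) :
    Summit.BirchSwinnertonDyer.WAllExclAddWildRankOneSurj := by
  unfold Summit.BirchSwinnertonDyer.WAllExclAddWildRankOneSurj
  intro W _ _ hncm hO6 hsurj hr
  obtain ⟨hH, hB, hLZZ⟩ := hW
  obtain ⟨hGZ, hKo, hGZK, hmod, hmodP, -, hGZ73, hFH, hpar, hHP⟩ := hF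
  haveI hN0 : NeZero (W.conductorNorm ℤ) := ⟨W.conductorNorm_pos_holds.ne'⟩
  -- (a) DATA. parity: `r_an = 1` is odd, so `w(E) = -1`
  have hw : W.rootNumber = -1 := by
    rcases W.rootNumber_eq_one_or with h | h
    · exfalso
      have heven : Even W.analyticRank := (hpar W).mpr h
      rw [hr] at heven
      exact Nat.not_even_one heven
    · exact h
  -- Friedberg–Hoffstein with auxiliary modulus `2`: Heegner for `N(E)`, `2` split, `L(E^{(d_K)},1) ≠ 0`
  obtain ⟨K, _, _, hK, -, hHN, hH2, hLt⟩ := hFH W hw 2 two_ne_zero 0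
  have hodd : Odd (NumberField.discr K) := by
    have h8 := Literature.SatisfiesHeegnerHypothesis.discr_emod_eight hK.1 hH2 (dvd_refl 2)
    rw [Int.odd_iff]; omega
  -- `3 ∣ N(E)` (additive) splits in `K`; hence `d_K ≠ -3`
  have h3N : 3 ∣ W.conductorNorm ℤ :=
    (W.dvd_conductorNorm_iff_not_hasGoodReductionAtPrime 3).mpr (not_good_of_addv W 3 hO6.2.1)
  have hsplit : SplitsIn K 3 := hHN 3 Nat.prime_three h3N
  have hd3 : NumberField.discr K ≠ -3 := by
    intro h
    exact Literature.SatisfiesHeegnerHypothesis.not_dvd_discr hK.1 hHN Nat.prime_three h3N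
      (by rw [h]; norm_num)
  -- the Heegner point over `K` and its datum; non-torsion by Gross–Zagier
  obtain ⟨P, Dt, H, ι, hP⟩ := hHP W K hK hHN
  have hL0 : W.entireLFunction 1 = 0 := entireLFunction_one_eq_zero_of_analyticRank_eq_one hr
  obtain ⟨-, hderiv⟩ := leadingLCoeff_eq_deriv_of_analyticRank_eq_one hr
  have hLK : LDerivEK W K ≠ 0 := by
    rw [lDerivEK_eq_deriv_mul W K hmod hL0]; exact mul_ne_zero hderiv hLt
  have hnt : ¬ IsOfFinAddOrder P :=
    (lDerivEK_ne_zero_iff_not_isOfFinAddOrder W (W.conductorNorm ℤ) K (hGZ _ W K) hK hHN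
      ⟨Dt, H, ι, hP⟩).mp hLK
  -- Kolyvagin: `rank E(K) = 1`, `Ш(E/K)` finite
  obtain ⟨hrk, hfin⟩ := hKo (W.conductorNorm ℤ) W K hK hHN ⟨Dt, H, ι, hP⟩ hnt
  -- a frame `(κ, γ, 𝔭)` and the other prime `𝔭′ ≠ 𝔭` above `3`
  obtain ⟨κ, γ, -, hκ, hγ, -⟩ := X11b.exists_anticyclotomic_generator_prime (p := 3) hK
  haveI : Fact (κ.IsTopGenerator γ) := ⟨hγ⟩
  obtain ⟨𝔭, h𝔭, he, hf⟩ := X11b.exists_degreeOnePrime_of_splitsIn K 3 hK.1 hsplit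
  obtain ⟨𝔭', hne, h𝔭', he', hf'⟩ := X11b.Three.exists_ne_degreeOne_prime hK.1 h𝔭 he hf
  -- (b) PLUMBING. the `R₀`-frame at `(κ, γ, 𝔭)` over the Friedberg–Hoffstein field (odd `d_K`) FROM PRINT, and its unit
  -- value, FORCED by the LZZ input (p594734 §1)
  obtain ⟨ι', hind, ΩK, Ωp, L, hΩK, hΩp, hBDP⟩ :=
    hS hH hB W (W.conductorNorm ℤ) K Dt hO6 rfl hK hHN hodd κ hκ γ 𝔭 h𝔭
  obtain ⟨u, hval⟩ := EisensteinKernelAtThreeRestrictedOfFrameOdd.exists_unit_hasValueAt_of_frame hLZZ W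
    (W.conductorNorm ℤ) K Dt H ι P hO6 rfl hK hHN hP hnt κ hκ γ 𝔭 h𝔭 he hf ι' hind hΩK hΩp hBDP
  -- the control INEQUALITY at `𝔭′` at slack `0` (CTL₀ included), from Poitou–Tate duality for Selmer structures ALONE
  have hctl : SchneiderFreeControlAtoms.AdditiveControlLeOnTreeAt 3 κ 𝔭' γ (embAt K 3 𝔭' h𝔭' he' hf') 0 P :=
    AdditiveRankOneControlLe.additiveControlLeOnTreeAt_of_poitouTate_of_heegner W 3 (by norm_num) hO6.2.1
      (W.conductorNorm ℤ) K (hPT K) Dt H ι P rfl hK hHN hP hnt (hKo _ W K) κ hκ γ 𝔭' h𝔭' he' hf'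
  obtain ⟨n, hn, hnle⟩ := hctl
  -- the value read through the logarithm at `𝔭′` (rank one: `(log_{𝔭′} P)² = (log_𝔭 P)²`)
  have hval' : L.HasValueAt 0 ((((u : unrIntegers 3) : unrIntegers 3) : ℂ_[3]) *
      (algebraMap ℚ_[3] ℂ_[3]
        (logOmega W 3 (embAt K 3 𝔭' h𝔭' he' hf') P / (Dt.c : ℚ_[3]))) ^ 2) :=
    (SchneiderFreeAdditiveX3.hasValueAt_sq_logOmega_embAt_iff_of_rank_one W 3 hK.1 hrk h𝔭 he hf
      h𝔭' he' hf' P _ _ L).mpr hval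
  -- the LOWER socket at slack `v₃(c)` at the frame `(κ, 𝔭′, γ, embAt 𝔭′)` — from `E_𝟙^V` (T = 0 only, AT the odd
  -- Friedberg–Hoffstein field and AT the displayed unit value `u, hval`), read through w2 g4's
  -- `imcLowerLe_iff_forall_norm_constantCoeff_le` at the control count's CTL₀
  have hc0 : Dt.c ≠ 0 := Dt.maninConstant_ne_zero_holds
  have hlog : logOmega W 3 (embAt K 3 𝔭' h𝔭' he' hf') P ≠ 0 := X11b.R1.logOmega_ne_zero W 3 _ hnt
  have hlow : SchneiderFree.AdditiveIMCLowerBDPOnTreeLeAt 3 κ 𝔭' γ (embAt K 3 𝔭' h𝔭' he' hf')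
      (padicValNat 3 Dt.c.natAbs) P :=
    (WildSplitEisensteinInclusionAtThreeTight.imcLowerLe_iff_forall_norm_constantCoeff_le hc0 hlog hn u hval').mpr
      (fun f hfI ↦ hE1V W (W.conductorNorm ℤ) K Dt H ι P hO6 hsurj hr rfl hK hHN hLt hP hnt hodd κ hκ γ 𝔭 h𝔭 he hf 𝔭'
        h𝔭' hne ι' hind ΩK Ωp L hΩK hΩp hBDP hn.1 u hval f hfI)
  -- STEP L at the Manin slack: the link consumes control ONLY as `≤` (utd-p3 g6, p593079 §3)
  have hlo : SchneiderFree.IndexLowerBoundLeAt W 3 K P (padicValNat 3 Dt.c.natAbs) :=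
    AdditiveRankOneControlLe.indexLowerBoundLeAt_of_imcLowerLe_of_controlLe_zero rfl hK hHN hfin hlow
      ⟨n, hn, hnle⟩
  -- the UPPER socket at slack `v₃(c)` IS the TOWER-FREE Kolyvagin crux `Ko′` (`d_K` odd, `≠ -3`; onto mod `3` only)
  have hupI : SchneiderFree.Upper.IndexUpperBoundLeAt W 3 K P (padicValNat 3 Dt.c.natAbs) :=
    hKoly W (W.conductorNorm ℤ) K Dt H ι P hO6 hsurj hr rfl hK hHN hLt hP hnt hodd hd3
  -- (c) TERMINAL STEP: a globally minimal model of the twist, then p528981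
  have hD0 : (NumberField.discr K : ℚ) ≠ 0 := by exact_mod_cast NumberField.discr_ne_zero K
  haveI : (W.quadraticTwist (NumberField.discr K : ℚ)).IsElliptic := W.isElliptic_quadraticTwist hD0
  obtain ⟨Cd, hCd⟩ := hasGlobalMinimalModel_rat_holds (W.quadraticTwist (NumberField.discr K : ℚ))
  haveI : (Cd • W.quadraticTwist (NumberField.discr K : ℚ)).IsGloballyMinimal := hCd
  exact SchneiderFree.Exact.bsdp_three_of_exactIndexManin_of_wAllExclAddWildRankZero hGZ hKo hGZK hmod
    hGZ73 hZ W hO6 hsurj hr (W.conductorNorm ℤ) K Dt H ι P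
    (Cd • W.quadraticTwist (NumberField.discr K : ℚ)) rfl hK hodd hHN hLt hP ⟨Cd, rfl⟩ hlo hupI

/-! ### §2 The same with the frame item 24475 (CLOSED) discharged by name -/

/-- **`PublishedInputsWildThree → E_𝟙^V → WildKolyvaginUpperAtThreeTowerFree → WildSplitPrintedInputsAtThree →
PoitouTateSelmerStructureDualityFact → WildRankZeroTwistAtThree → WAllExclAddWildRankOneSurj`**: §1 with the `R₀`-frame item
`WildSplitFrameAtThreeOddOfPrint` (24475, CLOSED·proved, p596578) supplied by `Theorems.wildSplitFrameAtThreeOddOfPrint_proof`;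
its two print antecedents (Hsieh 2014 Thm A, BDP 2013) are the first two conjuncts of the package. So, modulo print + PT1 + the
rank-zero leaf Z, the onto wild rank-one leaf ⟸ {`E_𝟙^V`, Ko′}. CONDITIONAL; closes nothing; BSD for no curve.
[cite: JetchevSkinnerWan2017, Thm. 3.3.1 and §7.4.1 (arXiv:1512.06894 pp. 11, 30)] [cite: Hsieh2014, Thm. A]
[cite: BertoliniDarmonPrasanna2013, Thm. 5.13] -/
theorem wAllExclAddWildRankOneSurj_of_valueAtOneV_of_koTowerFree_of_package_of_poitouTate
    (hF : PublishedInputsWildThree)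
    (hE1V : ∀ (W : WeierstrassCurve ℚ) [W.IsElliptic] [W.IsGloballyMinimal] (N : ℕ) [NeZero N] (K : Type) [Field K] [NumberField K] (Dt : Literature.NumberTheory.EllipticCurves.ModularForms.ModularParametrizationData W N) (H : Literature.NumberTheory.EllipticCurves.HeegnerDatum N (NumberField.discr K)) (ι : K →+* ℂ) (P : (W.baseChange K).toAffine.Point), Summit.BirchSwinnertonDyer.Rank1Residual.Additive.ClassO6 W 3 → W.HasSurjectiveModNGaloisRep 3 → W.analyticRank = 1 → W.conductorNorm ℤ = N → Literature.NumberTheory.EllipticCurves.IsImaginaryQuadratic K → Literature.NumberTheory.EllipticCurves.SatisfiesHeegnerHypothesis N K → (W.quadraticTwist (NumberField.discr K : ℚ)).entireLFunction 1 ≠ 0 → (WeierstrassCurve.Affine.Point.map ι.toRatAlgHom) P = Literature.NumberTheory.EllipticCurves.ModularForms.heegnerPointComplex Dt H → ¬ IsOfFinAddOrder P → Odd (NumberField.discr K) → ∀ (κ : Literature.NumberTheory.EllipticCurves.ZpExtension K 3), κ.IsAnticyclotomic → ∀ (γ : Field.absoluteGaloisGroup K) [Fact (κ.IsTopGenerator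 γ)] (𝔭 : IsDedekindDomain.HeightOneSpectrum (NumberField.RingOfIntegers K)) (h𝔭 : ((3 : ℕ) : NumberField.RingOfIntegers K) ∈ 𝔭.asIdeal) (he : 𝔭.asIdeal.ramificationIdx (NumberField.RingOfIntegers ℚ) = 1) (hf : 𝔭.asIdeal.inertiaDeg (NumberField.RingOfIntegers ℚ) = 1), ∀ (𝔭' : IsDedekindDomain.HeightOneSpectrum (NumberField.RingOfIntegers K)), ((3 : ℕ) : NumberField.RingOfIntegers K) ∈ 𝔭'.asIdeal → 𝔭' ≠ 𝔭 → ∀ (ι' : PadicAlgCl 3 ≃+* ℂ), Summit.BirchSwinnertonDyer.BirchSwinnertonDyer.Theorems.SchneiderFree.BranchInducesPrime 3 ι' 𝔭 → ∀ (ΩK : ℂ) (Ωp : ℂ_[3]) (L : Literature.NumberTheory.EllipticCurves.UnrSeries 3), ΩK ≠ 0 → Ωp ≠ 0 → Literature.NumberTheory.EllipticCurves.IsBDPLFunction ι' 𝔭 κ γ Dt.f ΩK Ωp L → Module.IsTorsion (Literature.NumberTheory.EllipticCurves.IwasawaAlgebra 3) (Summit.BirchSwinnertonDyer.Rank1Residual.X11b.AcSelmer.XAc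 (W.baseChange K) 3 κ 𝔭' ∅ γ) → ∀ (u : (Literature.NumberTheory.EllipticCurves.unrIntegers 3)ˣ), L.HasValueAt 0 ((((u : Literature.NumberTheory.EllipticCurves.unrIntegers 3) : Literature.NumberTheory.EllipticCurves.unrIntegers 3) : ℂ_[3]) * (algebraMap ℚ_[3] ℂ_[3] (Summit.BirchSwinnertonDyer.Rank1Residual.X11b.Halves.logOmega W 3 (Summit.BirchSwinnertonDyer.Rank1Residual.X11b.embAt K 3 𝔭 h𝔭 he hf) P / (Dt.c : ℚ_[3]))) ^ 2) → ∀ (f : Literature.NumberTheory.EllipticCurves.IwasawaAlgebra 3), Summit.BirchSwinnertonDyer.Rank1Residual.X11b.AcSelmer.XAc.charIdeal (W.baseChange K) 3 κ 𝔭' ∅ γ = Ideal.span {f} → ‖((PowerSeries.constantCoeff f : ℤ_[3]) : ℚ_[3])‖ ≤ ‖((PowerSeries.constantCoeff L : Literature.NumberTheory.EllipticCurves.unrIntegers 3) : ℂ_[3])‖)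
    (hKoly : WildKolyvaginUpperAtThreeTowerFree)
    (hW : WildSplitPrintedInputsAtThree)
    (hPT : PoitouTateSelmerStructureDualityFact)
    (hZ : WildRankZeroTwistAtThree) :
    Summit.BirchSwinnertonDyer.WAllExclAddWildRankOneSurj :=
  wAllExclAddWildRankOneSurj_of_valueAtOneV_of_koTowerFree_of_frameOdd_of_poitouTate hF hE1V hKoly hW
    (fun hH hB ↦ wildSplitFrameAtThreeOddOfPrint_proof hH hB) hPT hZ

/-! ### §3 The act-G shape (route rev 18): Ko′ from the three primitives + Jetchev max-form mod 3 + `J‴` -/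

/-- **`PublishedInputsWildThree → E_𝟙^V → KolyvaginPrimitivesAtThree → JetchevMaxDivisibilityAtThreeModThree →
WildSigmaDivisibilityAtThreeMultiCarrier → WildSplitPrintedInputsAtThree → PoitouTateSelmerStructureDualityFact →
WildRankZeroTwistAtThree → WAllExclAddWildRankOneSurj`** — the act-G′ kernel (`EisensteinKernelAtThreeMultiCarrierOddOfValueAtOne`,
pen bsd-wall-pss3x g3, `soedH/SketchGp.lean`) with its Eisenstein binder weakened from `E_𝟙′` to the minimal currency
`E_𝟙^V`: destructure the print package `KolyvaginPrimitivesAtThree = CT ∧ 3.7(2) ∧ E⁰`, feed the Jetchev max-form debt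
`hJmax hPT hE0 h372` and `J‴` to soed-p2's
`WildKolyvaginUpperAtThreeTowerFreePrintClosedSubcells.wildKolyvaginUpperAtThreeTowerFree_of_sigmaMultiCarrier_of_jetchevMaxModThree_of_threePrimitives`
(p598295) for the tower-free Kolyvagin upper bound Ko′, then §2. If the pen types crux #2″ as `E_𝟙^V`, this IS the
`closes` kernel's closer term; if as `E_𝟙′`, compose with §4. CONDITIONAL; closes nothing; BSD for no curve.
[cite: JetchevSkinnerWan2017, Thm. 3.3.1 and §7.4.1 (arXiv:1512.06894 pp. 11, 30)] [cite: McCallumLMS1991, §3]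
[cite: GrossLMS1991, Prop. 3.7(2) and §6] [cite: Jetchev2008, Thm. 1.4] -/
theorem wAllExclAddWildRankOneSurj_of_valueAtOneV_of_sigmaMultiCarrier_of_jetchevMaxModThree_of_primitives_of_poitouTate
    (hF : PublishedInputsWildThree)
    (hE1V : ∀ (W : WeierstrassCurve ℚ) [W.IsElliptic] [W.IsGloballyMinimal] (N : ℕ) [NeZero N] (K : Type) [Field K] [NumberField K] (Dt : Literature.NumberTheory.EllipticCurves.ModularForms.ModularParametrizationData W N) (H : Literature.NumberTheory.EllipticCurves.HeegnerDatum N (NumberField.discr K)) (ι : K →+* ℂ) (P : (W.baseChange K).toAffine.Point), Summit.BirchSwinnertonDyer.Rank1Residual.Additive.ClassO6 W 3 → W.HasSurjectiveModNGaloisRep 3 → W.analyticRank = 1 → W.conductorNorm ℤ = N → Literature.NumberTheory.EllipticCurves.IsImaginaryQuadratic K → Literature.NumberTheory.EllipticCurves.SatisfiesHeegnerHypothesis N K → (W.quadraticTwist (NumberField.discr K : ℚ)).entireLFunction 1 ≠ 0 → (WeierstrassCurve.Affine.Point.map ι.toRatAlgHom) P = Literature.NumberTheory.EllipticCurves.ModularForms.heegnerPointComplex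 Dt H → ¬ IsOfFinAddOrder P → Odd (NumberField.discr K) → ∀ (κ : Literature.NumberTheory.EllipticCurves.ZpExtension K 3), κ.IsAnticyclotomic → ∀ (γ : Field.absoluteGaloisGroup K) [Fact (κ.IsTopGenerator γ)] (𝔭 : IsDedekindDomain.HeightOneSpectrum (NumberField.RingOfIntegers K)) (h𝔭 : ((3 : ℕ) : NumberField.RingOfIntegers K) ∈ 𝔭.asIdeal) (he : 𝔭.asIdeal.ramificationIdx (NumberField.RingOfIntegers ℚ) = 1) (hf : 𝔭.asIdeal.inertiaDeg (NumberField.RingOfIntegers ℚ) = 1), ∀ (𝔭' : IsDedekindDomain.HeightOneSpectrum (NumberField.RingOfIntegers K)), ((3 : ℕ) : NumberField.RingOfIntegers K) ∈ 𝔭'.asIdeal → 𝔭' ≠ 𝔭 → ∀ (ι' : PadicAlgCl 3 ≃+* ℂ), Summit.BirchSwinnertonDyer.BirchSwinnertonDyer.Theorems.SchneiderFree.BranchInducesPrime 3 ι' 𝔭 → ∀ (ΩK : ℂ) (Ωp : ℂ_[3]) (L : Literature.NumberTheory.EllipticCurves.UnrSeries 3), ΩK ≠ 0 → Ωp ≠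 0 → Literature.NumberTheory.EllipticCurves.IsBDPLFunction ι' 𝔭 κ γ Dt.f ΩK Ωp L → Module.IsTorsion (Literature.NumberTheory.EllipticCurves.IwasawaAlgebra 3) (Summit.BirchSwinnertonDyer.Rank1Residual.X11b.AcSelmer.XAc (W.baseChange K) 3 κ 𝔭' ∅ γ) → ∀ (u : (Literature.NumberTheory.EllipticCurves.unrIntegers 3)ˣ), L.HasValueAt 0 ((((u : Literature.NumberTheory.EllipticCurves.unrIntegers 3) : Literature.NumberTheory.EllipticCurves.unrIntegers 3) : ℂ_[3]) * (algebraMap ℚ_[3] ℂ_[3] (Summit.BirchSwinnertonDyer.Rank1Residual.X11b.Halves.logOmega W 3 (Summit.BirchSwinnertonDyer.Rank1Residual.X11b.embAt K 3 𝔭 h𝔭 he hf) P / (Dt.c : ℚ_[3]))) ^ 2) → ∀ (f : Literature.NumberTheory.EllipticCurves.IwasawaAlgebra 3), Summit.BirchSwinnertonDyer.Rank1Residual.X11b.AcSelmer.XAc.charIdeal (W.baseChange K) 3 κ 𝔭' ∅ γ = Ideal.span {f} → ‖((PowerSeries.constantCoeff f : ℤ_[3]) : ℚ_[3])‖ ≤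 ‖((PowerSeries.constantCoeff L : Literature.NumberTheory.EllipticCurves.unrIntegers 3) : ℂ_[3])‖)
    (hPr : KolyvaginPrimitivesAtThree)
    (hJmax : JetchevMaxDivisibilityAtThreeModThree)
    (hJ : WildSigmaDivisibilityAtThreeMultiCarrier)
    (hW : WildSplitPrintedInputsAtThree)
    (hPT : PoitouTateSelmerStructureDualityFact)
    (hZ : WildRankZeroTwistAtThree) :
    Summit.BirchSwinnertonDyer.WAllExclAddWildRankOneSurj := by
  obtain ⟨hCT, h372, hE0⟩ := hPr
  exact wAllExclAddWildRankOneSurj_of_valueAtOneV_of_koTowerFree_of_package_of_poitouTate hF hE1V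
    (WildKolyvaginUpperAtThreeTowerFreePrintClosedSubcells.wildKolyvaginUpperAtThreeTowerFree_of_sigmaMultiCarrier_of_jetchevMaxModThree_of_threePrimitives
      hCT h372 hE0 (hJmax hPT hE0 h372) hJ)
    hW hPT hZ

/-! ### §4 `E_𝟙′ ⟹ E_𝟙^V` by text -/

/-- **`E_𝟙′ ⟹ E_𝟙^V`**: the queued crux #2″ `WildSplitEisensteinValueAtOneRestricted` (text displayed as the hypothesis;
= p588074's `hE1`, = the registered `stub_valueAtOneRestricted` of line `birth` on 24155, = binder 2 of kernel⁗ p606694)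
implies w2 g4's minimal currency `E_𝟙^V` (displayed as the conclusion): `E_𝟙^V` is `E_𝟙′` with the EXTRA hypotheses
`Odd d_K` and a unit value display `u, hval`, which are simply dropped. Hence every `E_𝟙^V`-keyed kernel of this file
yields the corresponding `E_𝟙′`-keyed kernel by composition. Pure logic; nothing asserted about any curve. -/
theorem valueAtOneV_of_valueAtOneRestricted
    (hE1 : ∀ (W : WeierstrassCurve ℚ) [W.IsElliptic] [W.IsGloballyMinimal] (N : ℕ) [NeZero N] (K : Type) [Field K] [NumberField K] (Dt : Literature.NumberTheory.EllipticCurves.ModularForms.ModularParametrizationData W N) (H : Literature.NumberTheory.EllipticCurves.HeegnerDatum N (NumberField.discr K)) (ι : K →+* ℂ) (P : (W.baseChange K).toAffine.Point), Summit.BirchSwinnertonDyer.Rank1Residual.Additive.ClassO6 W 3 → W.HasSurjectiveModNGaloisRep 3 → W.analyticRank = 1 → W.conductorNorm ℤ = N → Literature.NumberTheory.EllipticCurves.IsImaginaryQuadratic K → Literature.NumberTheory.EllipticCurves.SatisfiesHeegnerHypothesis N K → (W.quadraticTwist (NumberField.discr K : ℚ)).entireLFunction 1 ≠ 0 → (WeierstrassCurve.Affine.Point.map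 ι.toRatAlgHom) P = Literature.NumberTheory.EllipticCurves.ModularForms.heegnerPointComplex Dt H → ¬ IsOfFinAddOrder P → ∀ (κ : Literature.NumberTheory.EllipticCurves.ZpExtension K 3), κ.IsAnticyclotomic → ∀ (γ : Field.absoluteGaloisGroup K) [Fact (κ.IsTopGenerator γ)] (𝔭 : IsDedekindDomain.HeightOneSpectrum (NumberField.RingOfIntegers K)), ((3 : ℕ) : NumberField.RingOfIntegers K) ∈ 𝔭.asIdeal → 𝔭.asIdeal.ramificationIdx (NumberField.RingOfIntegers ℚ) = 1 → 𝔭.asIdeal.inertiaDeg (NumberField.RingOfIntegers ℚ) = 1 → ∀ (𝔭' : IsDedekindDomain.HeightOneSpectrum (NumberField.RingOfIntegers K)), ((3 : ℕ) : NumberField.RingOfIntegers K) ∈ 𝔭'.asIdeal → 𝔭' ≠ 𝔭 → ∀ (ι' : PadicAlgCl 3 ≃+* ℂ), Summit.BirchSwinnertonDyer.BirchSwinnertonDyer.Theorems.SchneiderFree.BranchInducesPrime 3 ι' 𝔭 → ∀ (ΩK : ℂ) (Ωp : ℂ_[3]) (L : Literature.NumberTheory.EllipticCurves.UnrSeries 3),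 ΩK ≠ 0 → Ωp ≠ 0 → Literature.NumberTheory.EllipticCurves.IsBDPLFunction ι' 𝔭 κ γ Dt.f ΩK Ωp L → Module.IsTorsion (Literature.NumberTheory.EllipticCurves.IwasawaAlgebra 3) (Summit.BirchSwinnertonDyer.Rank1Residual.X11b.AcSelmer.XAc (W.baseChange K) 3 κ 𝔭' ∅ γ) → ∀ (f : Literature.NumberTheory.EllipticCurves.IwasawaAlgebra 3), Summit.BirchSwinnertonDyer.Rank1Residual.X11b.AcSelmer.XAc.charIdeal (W.baseChange K) 3 κ 𝔭' ∅ γ = Ideal.span {f} → ‖((PowerSeries.constantCoeff f : ℤ_[3]) : ℚ_[3])‖ ≤ ‖((PowerSeries.constantCoeff L : Literature.NumberTheory.EllipticCurves.unrIntegers 3) : ℂ_[3])‖) :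
    ∀ (W : WeierstrassCurve ℚ) [W.IsElliptic] [W.IsGloballyMinimal] (N : ℕ) [NeZero N] (K : Type) [Field K] [NumberField K] (Dt : Literature.NumberTheory.EllipticCurves.ModularForms.ModularParametrizationData W N) (H : Literature.NumberTheory.EllipticCurves.HeegnerDatum N (NumberField.discr K)) (ι : K →+* ℂ) (P : (W.baseChange K).toAffine.Point), Summit.BirchSwinnertonDyer.Rank1Residual.Additive.ClassO6 W 3 → W.HasSurjectiveModNGaloisRep 3 → W.analyticRank = 1 → W.conductorNorm ℤ = N → Literature.NumberTheory.EllipticCurves.IsImaginaryQuadratic K → Literature.NumberTheory.EllipticCurves.SatisfiesHeegnerHypothesis N K → (W.quadraticTwist (NumberField.discr K : ℚ)).entireLFunction 1 ≠ 0 → (WeierstrassCurve.Affine.Point.map ι.toRatAlgHom) P = Literature.NumberTheory.EllipticCurves.ModularForms.heegnerPointComplex Dt H → ¬ IsOfFinAddOrder P → Odd (NumberField.discr K) → ∀ (κ : Literature.NumberTheory.EllipticCurves.ZpExtension K 3), κ.IsAnticyclotomic → ∀ (γ : Field.absoluteGaloisGroup K) [Fact (κ.IsTopGenerator γ)] (𝔭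 : IsDedekindDomain.HeightOneSpectrum (NumberField.RingOfIntegers K)) (h𝔭 : ((3 : ℕ) : NumberField.RingOfIntegers K) ∈ 𝔭.asIdeal) (he : 𝔭.asIdeal.ramificationIdx (NumberField.RingOfIntegers ℚ) = 1) (hf : 𝔭.asIdeal.inertiaDeg (NumberField.RingOfIntegers ℚ) = 1), ∀ (𝔭' : IsDedekindDomain.HeightOneSpectrum (NumberField.RingOfIntegers K)), ((3 : ℕ) : NumberField.RingOfIntegers K) ∈ 𝔭'.asIdeal → 𝔭' ≠ 𝔭 → ∀ (ι' : PadicAlgCl 3 ≃+* ℂ), Summit.BirchSwinnertonDyer.BirchSwinnertonDyer.Theorems.SchneiderFree.BranchInducesPrime 3 ι' 𝔭 → ∀ (ΩK : ℂ) (Ωp : ℂ_[3]) (L : Literature.NumberTheory.EllipticCurves.UnrSeries 3), ΩK ≠ 0 → Ωp ≠ 0 → Literature.NumberTheory.EllipticCurves.IsBDPLFunction ι' 𝔭 κ γ Dt.f ΩK Ωp L → Module.IsTorsion (Literature.NumberTheory.EllipticCurves.IwasawaAlgebra 3) (Summit.BirchSwinnertonDyer.Rank1Residual.X11b.AcSelmer.XAc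 (W.baseChange K) 3 κ 𝔭' ∅ γ) → ∀ (u : (Literature.NumberTheory.EllipticCurves.unrIntegers 3)ˣ), L.HasValueAt 0 ((((u : Literature.NumberTheory.EllipticCurves.unrIntegers 3) : Literature.NumberTheory.EllipticCurves.unrIntegers 3) : ℂ_[3]) * (algebraMap ℚ_[3] ℂ_[3] (Summit.BirchSwinnertonDyer.Rank1Residual.X11b.Halves.logOmega W 3 (Summit.BirchSwinnertonDyer.Rank1Residual.X11b.embAt K 3 𝔭 h𝔭 he hf) P / (Dt.c : ℚ_[3]))) ^ 2) → ∀ (f : Literature.NumberTheory.EllipticCurves.IwasawaAlgebra 3), Summit.BirchSwinnertonDyer.Rank1Residual.X11b.AcSelmer.XAc.charIdeal (W.baseChange K) 3 κ 𝔭' ∅ γ = Ideal.span {f} → ‖((PowerSeries.constantCoeff f : ℤ_[3]) : ℚ_[3])‖ ≤ ‖((PowerSeries.constantCoeff L : Literature.NumberTheory.EllipticCurves.unrIntegers 3) : ℂ_[3])‖ := by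
  intro W _ _ N _ K _ _ Dt H ι P hO6 hsurj hr hN hK hHH hLt hP hnt _hodd κ hκ γ _ 𝔭 h𝔭 he hf 𝔭' h𝔭' hne ι' hι'
    ΩK Ωp L hΩK hΩp hBDP htor _u _hval f hfI
  exact hE1 W N K Dt H ι P hO6 hsurj hr hN hK hHH hLt hP hnt κ hκ γ 𝔭 h𝔭 he hf 𝔭' h𝔭' hne ι' hι' ΩK Ωp L hΩK hΩp
    hBDP htor f hfI

end Summit.BirchSwinnertonDyer.BirchSwinnertonDyer.Theorems.EisensteinKernelAtThreeOfValueAtOneV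

end
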